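/-
Copyright (c) 2026. All rights reserved.
Released under Apache 2.0 license as described in the file LICENSE.
-/
import Summits.ValiantsHypothesis.ValiantsHypothesis.Theorems.SuccinctCirculationHashing
import Summits.ValiantsHypothesis.ValiantsHypothesis.Theorems.IsolationRounds

/-!
# Constant-free read-once templates: the support of the determinant

Stage S4c-ii-a of the O-L2-14 isolation series ([cite: FennerGurjarThierauf2016, Section 3]
through the [cite: ForbesShpilkaVolk2018, §8] dictionary): the algebra of a READ-ONCE,
CONSTANT-FREE determinant template and the arithmetic of the parameters, consumed by
`ReadOnceCFIsolation` (S4c-ii-b).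

* §5 TEMPLATE: a matrix `E` over `M ⊕ F` (variables / constants); `varRel` = variable positions,
  `varLab` = their labels, `monoOf σ` = the monomial of a permutation; constant-free ⇒ the Leibniz
  term of a non-admissible `σ` vanishes, read-once ⇒ admissible permutations have distinct
  monomials, so the support of `det` is exactly `{monoOf σ : σ admissible}` (`coeff_det_eq`,
  `exists_perm_of_mem_support`, `monoOf_mem_support`) and the hypotheses `hlab`
  (`varLab_inj`) / `hadm` (`exists_perm_of_det_ne_zero`) of S4b's `exists_isolating_rounds` hold.
* §6 ARITHMETIC of the parameters (`card_bound`, `block_bound`, `rounds_bound`, `size_bound`).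
Currency: kernel-certified helper for the W4 isolation road (stage S4c-ii-a); closes no item;
data defs `varRel` / `varLab` / `monoOf`, no facts, no doors.
-/

set_option linter.dupNamespace false

namespace Summit.ValiantsHypothesis.ValiantsHypothesis.Theorems.ReadOnceCFSupport

open MvPolynomial

/-! ### §5 The template: variable positions, labels, monomials of admissible permutations -/

section Template

variable {F : Type*} [Field F] {M : Type*} {r : ℕ}

/-- Column `k` may take row `j`: the entry `(j, k)` of the template is a variable. [folklore] -/
def varRel (E : Matrix (Fin r) (Fin r) (M ⊕ F)) : Fin r → Fin r → Bool := fun k j => (E j k).isLeft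

/-- The variable at entry `(j, k)` (default `μ₀` on constant entries). [folklore] -/
def varLab (μ₀ : M) (E : Matrix (Fin r) (Fin r) (M ⊕ F)) : Fin r → Fin r → M :=
  fun k j => Sum.elim id (fun _ => μ₀) (E j k)

/-- The (multilinear) monomial `∏_k x_{lab k (σ k)}` of a permutation, as an exponent vector.
[folklore] -/
noncomputable def monoOf (lab : Fin r → Fin r → M) (σ : Equiv.Perm (Fin r)) : M →₀ ℕ :=
  ∑ k, Finsupp.single (lab k (σ k)) 1

omit [Field F] in
/-- A variable position holds its label. [this file] -/
theorem eq_inl_varLab (μ₀ : M) (E : Matrix (Fin r) (Fin r) (M ⊕ F)) {k j : Fin r}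
    (h : varRel E k j) : E j k = Sum.inl (varLab μ₀ E k j) := by
  unfold varLab
  cases hE : E j k with
  | inl m => rfl
  | inr c => simp [varRel, hE] at h

omit [Field F] in
/-- Read-once ⇒ the labelling is injective on variable positions (hypothesis `hlab` of S4b).
[cite: ForbesShpilkaVolk2018, §8] -/
theorem varLab_inj (μ₀ : M) (E : Matrix (Fin r) (Fin r) (M ⊕ F))
    (hro : ∀ p q : Fin r × Fin r, ∀ m, E p.1 p.2 = Sum.inl m → E q.1 q.2 = Sum.inl m → p = q) :
    ∀ i j i' j', varRel E i j → varRel E i' j' → varLab μ₀ E i j = varLab μ₀ E i' j' →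
      i = i' ∧ j = j' := by
  intro i j i' j' h h' he
  have h1 := eq_inl_varLab μ₀ E h
  rw [he] at h1
  have hpq := hro (j, i) (j', i') _ h1 (eq_inl_varLab μ₀ E h')
  simp only [Prod.mk.injEq] at hpq
  exact ⟨hpq.2, hpq.1⟩

/-- The weight of the monomial of `σ` is the weight of the matching. [folklore] -/
theorem sum_monoOf (lab : Fin r → Fin r → M) (σ : Equiv.Perm (Fin r)) (w : M → ℕ) :
    ((monoOf lab σ).sum fun μ k => k * w μ) = ∑ k, w (lab k (σ k)) := by
  unfold monoOf
  rw [← Finsupp.sum_finsetSum_index (h := fun μ k => k * w μ) (fun _ => by simp)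
    (fun _ _ _ => by simp [add_mul])]
  exact Finset.sum_congr rfl fun k _ => by rw [Finsupp.sum_single_index] <;> simp

/-- A variable occurs in the monomial of `σ` iff `σ` passes through a position labelled by it.
[this file] -/
theorem monoOf_apply_ne_zero {lab : Fin r → Fin r → M} {σ : Equiv.Perm (Fin r)} {v : M} :
    monoOf lab σ v ≠ 0 ↔ ∃ k, lab k (σ k) = v := by
  classical
  unfold monoOf
  rw [Finsupp.finsetSum_apply]
  constructor
  · intro h
    obtain ⟨k, -, hk⟩ := Finset.exists_ne_zero_of_sum_ne_zero h
    exact ⟨k, (Finsupp.single_apply_ne_zero.1 hk).1.symm⟩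
  · rintro ⟨k, hk⟩
    refine Nat.pos_iff_ne_zero.1 (lt_of_lt_of_le Nat.one_pos ?_)
    calc 1 = Finsupp.single (lab k (σ k)) 1 v := by rw [hk, Finsupp.single_eq_same]
      _ ≤ ∑ k', Finsupp.single (lab k' (σ k')) 1 v :=
        Finset.single_le_sum (f := fun k' => Finsupp.single (lab k' (σ k')) 1 v)
          (fun _ _ => Nat.zero_le _) (Finset.mem_univ k)

/-- Leibniz term of an admissible `σ`: the monomial of `σ` with coefficient `1`. [folklore] -/
theorem prod_entry_of_adm (μ₀ : M) (E : Matrix (Fin r) (Fin r) (M ⊕ F)) {σ : Equiv.Perm (Fin r)}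
    (hσ : ∀ k, varRel E k (σ k)) :
    ∏ k, Sum.elim MvPolynomial.X MvPolynomial.C (E (σ k) k) =
      monomial (monoOf (varLab μ₀ E) σ) (1 : F) := by
  rw [monoOf, monomial_sum_one]
  refine Finset.prod_congr rfl fun k _ => ?_
  rw [eq_inl_varLab μ₀ E (hσ k)]
  rfl

/-- Leibniz term of a non-admissible `σ` of a constant-free template: `0` (a factor `C 0`).
[folklore] -/
theorem prod_entry_of_not_adm (E : Matrix (Fin r) (Fin r) (M ⊕ F))
    (hcf : ∀ (i j : Fin r) (c : F), E i j = Sum.inr c → c = 0) {σ : Equiv.Perm (Fin r)}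
    (hσ : ¬ ∀ k, varRel E k (σ k)) :
    ∏ k, Sum.elim MvPolynomial.X MvPolynomial.C (E (σ k) k) = (0 : MvPolynomial M F) := by
  obtain ⟨k, hk⟩ := not_forall.1 hσ
  apply Finset.prod_eq_zero (Finset.mem_univ k)
  cases hE : E (σ k) k with
  | inl m => exact absurd (by simp [varRel, hE]) hk
  | inr c => rw [Sum.elim_inr, hcf _ _ c hE, MvPolynomial.C_0]

/-- Coefficients of a constant-free determinant: a signed count over admissible permutations with
that monomial. [folklore] -/
theorem coeff_det_eq [DecidableEq M] (μ₀ : M) (E : Matrix (Fin r) (Fin r) (M ⊕ F))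
    (hcf : ∀ (i j : Fin r) (c : F), E i j = Sum.inr c → c = 0) (m : M →₀ ℕ) :
    coeff m (E.map (Sum.elim MvPolynomial.X MvPolynomial.C)).det =
      ∑ σ ∈ Finset.univ.filter (fun σ : Equiv.Perm (Fin r) =>
        (∀ k, (E (σ k) k).isLeft = true) ∧ monoOf (varLab μ₀ E) σ = m),
        ((Equiv.Perm.sign σ : ℤ) : F) := by
  rw [Matrix.det_apply', MvPolynomial.coeff_sum, Finset.sum_filter]
  refine Finset.sum_congr rfl fun σ _ => ?_
  have hC : ((Equiv.Perm.sign σ : ℤ) : MvPolynomial M F) = C ((Equiv.Perm.sign σ : ℤ) : F) :=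
    (map_intCast (C : F →+* MvPolynomial M F) _).symm
  rw [hC, MvPolynomial.coeff_C_mul]
  simp only [Matrix.map_apply]
  by_cases hσ : ∀ k, varRel E k (σ k)
  · have hσ' : ∀ k, (E (σ k) k).isLeft = true := hσ
    rw [prod_entry_of_adm μ₀ E hσ, MvPolynomial.coeff_monomial]
    by_cases hm : monoOf (varLab μ₀ E) σ = m <;> simp [hm, hσ']
  · have hσ' : ¬ ∀ k, (E (σ k) k).isLeft = true := hσ
    rw [prod_entry_of_not_adm E hcf hσ, MvPolynomial.coeff_zero, mul_zero]
    simp [hσ']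

/-- Every monomial in the support comes from an admissible permutation. [folklore] -/
theorem exists_perm_of_mem_support (μ₀ : M) (E : Matrix (Fin r) (Fin r) (M ⊕ F))
    (hcf : ∀ (i j : Fin r) (c : F), E i j = Sum.inr c → c = 0) {m : M →₀ ℕ}
    (hm : m ∈ (E.map (Sum.elim MvPolynomial.X MvPolynomial.C)).det.support) :
    ∃ σ : Equiv.Perm (Fin r), (∀ k, varRel E k (σ k)) ∧ monoOf (varLab μ₀ E) σ = m := by
  classical
  rw [MvPolynomial.mem_support_iff, coeff_det_eq μ₀ E hcf] at hm
  obtain ⟨σ, hσ, -⟩ := Finset.exists_ne_zero_of_sum_ne_zero hm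
  rw [Finset.mem_filter] at hσ
  exact ⟨σ, hσ.2.1, hσ.2.2⟩

/-- A nonzero constant-free determinant has an admissible permutation (hypothesis `hadm` of S4b).
[folklore] -/
theorem exists_perm_of_det_ne_zero (E : Matrix (Fin r) (Fin r) (M ⊕ F))
    (hcf : ∀ (i j : Fin r) (c : F), E i j = Sum.inr c → c = 0)
    (h : (E.map (Sum.elim MvPolynomial.X MvPolynomial.C)).det ≠ 0) :
    ∃ σ : Equiv.Perm (Fin r), ∀ k, varRel E k (σ k) := by
  rw [Matrix.det_apply'] at h
  obtain ⟨σ, -, hσ⟩ := Finset.exists_ne_zero_of_sum_ne_zero h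
  refine ⟨σ, ?_⟩
  by_contra hn
  apply hσ
  simp only [Matrix.map_apply]
  rw [prod_entry_of_not_adm E hcf hn, mul_zero]

omit [Field F] in
/-- Read-once: admissible permutations have distinct monomials (no cancellation). [folklore] -/
theorem monoOf_injOn (μ₀ : M) (E : Matrix (Fin r) (Fin r) (M ⊕ F))
    (hro : ∀ p q : Fin r × Fin r, ∀ m, E p.1 p.2 = Sum.inl m → E q.1 q.2 = Sum.inl m → p = q)
    {σ τ : Equiv.Perm (Fin r)} (hσ : ∀ k, varRel E k (σ k)) (hτ : ∀ k, varRel E k (τ k))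
    (h : monoOf (varLab μ₀ E) σ = monoOf (varLab μ₀ E) τ) : σ = τ := by
  refine Equiv.ext fun k => ?_
  have hk : monoOf (varLab μ₀ E) τ (varLab μ₀ E k (σ k)) ≠ 0 := by
    rw [← h]
    exact monoOf_apply_ne_zero.2 ⟨k, rfl⟩
  obtain ⟨k', hk'⟩ := monoOf_apply_ne_zero.1 hk
  obtain ⟨h1, h2⟩ := varLab_inj μ₀ E hro k' (τ k') k (σ k) (hτ k') (hσ k) hk'
  subst h1
  exact h2.symm

/-- Read-once and constant-free: the monomial of an admissible permutation is in the support
(coefficient `sign σ = ±1 ≠ 0`). [folklore] -/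
theorem monoOf_mem_support (μ₀ : M) (E : Matrix (Fin r) (Fin r) (M ⊕ F))
    (hro : ∀ p q : Fin r × Fin r, ∀ m, E p.1 p.2 = Sum.inl m → E q.1 q.2 = Sum.inl m → p = q)
    (hcf : ∀ (i j : Fin r) (c : F), E i j = Sum.inr c → c = 0) {σ : Equiv.Perm (Fin r)}
    (hσ : ∀ k, varRel E k (σ k)) :
    monoOf (varLab μ₀ E) σ ∈ (E.map (Sum.elim MvPolynomial.X MvPolynomial.C)).det.support := by
  classical
  rw [MvPolynomial.mem_support_iff, coeff_det_eq μ₀ E hcf, Finset.sum_eq_single σ]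
  · rcases Int.units_eq_one_or (Equiv.Perm.sign σ) with h | h <;> simp [h]
  · intro τ hτ hne
    rw [Finset.mem_filter] at hτ
    exact absurd (monoOf_injOn μ₀ E hro hτ.2.1 hσ hτ.2.2) hne
  · intro h
    exact absurd (Finset.mem_filter.2 ⟨Finset.mem_univ _, hσ, rfl⟩) h

end Template

/-! ### §6 Arithmetic of the parameters -/

/-- `r ≤ binom(2n,n)^a ≤ 2^{2na}`. [this file] -/
theorem le_two_pow_of_le {n a r : ℕ} (hr : r ≤ (Nat.choose (2 * n) n) ^ a) : r ≤ 2 ^ (2 * n * a) :=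
  calc r ≤ (Nat.choose (2 * n) n) ^ a := hr
    _ ≤ (2 ^ (2 * n)) ^ a := Nat.pow_le_pow_left (Nat.choose_le_two_pow _ _) _
    _ = 2 ^ (2 * n * a) := by rw [← pow_mul]

/-- `(2r)^4 ≤ 2^{n²}` patterns fit S1's family bound at level `2`. [folklore] -/
theorem card_bound {n a r : ℕ} (hr : r ≤ (Nat.choose (2 * n) n) ^ a) (hn : 8 * a + 4 ≤ n) :
    (r + r) ^ 4 ≤ 2 ^ n ^ 2 := by
  have h1 := le_two_pow_of_le hr
  have h2 : (8 * a + 4) * n ≤ n * n := Nat.mul_le_mul_right n hn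
  calc (r + r) ^ 4 ≤ (2 ^ (2 * n * a + 1)) ^ 4 :=
        Nat.pow_le_pow_left (by rw [pow_succ]; omega) _
    _ = 2 ^ ((2 * n * a + 1) * 4) := by rw [← pow_mul]
    _ ≤ 2 ^ n ^ 2 := Nat.pow_le_pow_right (by norm_num) (by rw [sq]; nlinarith [h2, hn])

/-- `r · 2^ℓ ≤ 2^{ℓ + 2na}` (the block width `B = ℓ + 2na` is carry-free). [folklore] -/
theorem block_bound {n a r : ℕ} (hr : r ≤ (Nat.choose (2 * n) n) ^ a) (ℓ : ℕ) :
    r * 2 ^ ℓ ≤ 2 ^ (ℓ + 2 * n * a) :=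
  calc r * 2 ^ ℓ ≤ 2 ^ (2 * n * a) * 2 ^ ℓ := Nat.mul_le_mul_right _ (le_two_pow_of_le hr)
    _ = 2 ^ (ℓ + 2 * n * a) := by rw [← pow_add, add_comm]

/-- `log₂ r + 1 ≤ 2na + 1` rounds. [folklore] -/
theorem rounds_bound {n a r : ℕ} (hr : r ≤ (Nat.choose (2 * n) n) ^ a) :
    Nat.log 2 r + 1 ≤ 2 * n * a + 1 := by
  have h := Nat.log_mono_right (b := 2) (le_two_pow_of_le hr)
  rw [Nat.log_pow (by norm_num)] at h
  omega

/-- The size bookkeeping: `T (1 + n^c) + T (n^c + 2na) ≤ n^{c+4}` for `T ≤ 2na + 1`,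
`n ≥ max 3 (2a+1)`, `c ≥ 1`. [folklore] -/
theorem size_bound {n a c T : ℕ} (hc : 1 ≤ c) (hn : 3 ≤ n) (ha : 2 * a + 1 ≤ n)
    (hT : T ≤ 2 * n * a + 1) :
    T * (1 + n ^ c) + T * (n ^ c + 2 * n * a) ≤ n ^ (c + 4) := by
  have h1 : (2 * a + 1) * n ≤ n * n := Nat.mul_le_mul_right n ha
  have hT' : T ≤ n * n := hT.trans (by nlinarith [h1, hn])
  have hna : 2 * n * a ≤ n * n := by nlinarith [h1]
  have hX : n ≤ n ^ c := by
    calc n = n ^ 1 := (pow_one n).symm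
      _ ≤ n ^ c := Nat.pow_le_pow_right (by omega) hc
  have hN : 9 ≤ n * n := by nlinarith [hn]
  have h5 : n * n + 2 * n ^ c + 1 ≤ n * n * n ^ c := by nlinarith [hN, hn.trans hX]
  calc T * (1 + n ^ c) + T * (n ^ c + 2 * n * a)
      ≤ n * n * (1 + n ^ c) + n * n * (n ^ c + n * n) :=
        Nat.add_le_add (Nat.mul_le_mul hT' le_rfl) (Nat.mul_le_mul hT' (by omega))
    _ = n * n * (n * n + 2 * n ^ c + 1) := by ring
    _ ≤ n * n * (n * n * n ^ c) := Nat.mul_le_mul_left _ h5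
    _ = n ^ (c + 4) := by ring

end Summit.ValiantsHypothesis.ValiantsHypothesis.Theorems.ReadOnceCFSupport
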